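import Summits.AtomisticToContinuum.FouriersLaw.Theses.MatthiessenLadder
import Literature.MathematicalPhysics.KineticTheory.SiteChainHormanderBrackets
import Literature.Analysis.Hypoelliptic.HormanderProof
import HarnessLib

/-!
# `PrefixSteadyStates`, line `registered` — stub `stub_cellChainSmoothDensity`

Crux item `stmt-AtomisticToContinuum-12778` (route `MatthiessenLadder`, decl
`…MatthiessenLadder.PrefixSteadyStates`), uniqueness clause, kernel-level stub U-a: every weak steady
state (`SiteChain.IsSteadyState`: probability measure, `∫ L f dμ = 0` for `f ∈ C_c^∞`, integrable
currents) of ANY cell chain `cellChain ω₂ lam β γ c` (`U_i = ω₂q²/2 + [c i] lam q⁴/4`,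
`V_i = r²/2 + [c i] β r⁴/4`, baths `γ` at the sites `0` and `N-1`) has a smooth density, for
`β ≥ 0`, `γ > 0`, `N ≥ 1`, `T_L, T_R > 0` (the hypotheses `ω₂ > 0`, `lam ≥ 0` of the registered
signature are not needed). Mechanism: the generator is the formal transpose of the Fokker–Planck
operator `L* = X_L² + X_R² + X₀ + 2γ` in Hörmander's form (`SiteChain.hormanderTranspose_eq_generator`),
whose family `(X₀ = -Y, X_L, X_R)` is bracket generating from the LEFT bath alone because every bond
has `V_i'' = 1 + 3β_i r² ≥ 1` (Cuneo–Eckmann–Hairer–Rey-Bellet 2018 Prop. 4.1 for site chains,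
`SiteChain.isBracketGenerating_langevinHormanderFamily`, Literature file
`SiteChainHormanderBrackets.lean`), and Hörmander 1967 Thm 1.1 is PROVED in the tree
(`Literature.Analysis.Hypoelliptic.hormander1967_thm11_proof`).
-/

noncomputable section

namespace Summit.AtomisticToContinuum.FouriersLaw.Theorems.PrefixSteadyStates.LineRegistered

open MeasureTheory ProbabilityTheory Filter Topology Set
open scoped NNReal ENNReal ContDiff
open Literature.MathematicalPhysics.KineticTheory.HeatConduction
open Literature.MathematicalPhysics.KineticTheory Literature.Probability.Process

/-- **Stub U-a — weak steady states of a cell chain have smooth densities.** For `ω₂ > 0`,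
`lam, β ≥ 0`, `γ > 0`, every cell indicator `c`, `N ≥ 1` and `T_L, T_R > 0`, every weak steady state of
`cellChain ω₂ lam β γ c` has a smooth density: Hörmander's Theorem 1.1 (proved in tree,
`hormander1967_thm11_proof`) for `ᵗ(L*) = L`, the bracket condition holding from the left bath because
every bond has `V_i'' = 1 + 3β_i r² ≥ 1` (Cuneo–Eckmann–Hairer–Rey-Bellet 2018 Prop. 4.1, site-chain
version `cellChain_hasSmoothDensity_of_isSteadyState`). [cite: CuneoEckmannHairerReyBellet2018, Prop 4.1] -/
theorem stub_cellChainSmoothDensity :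
    ∀ ω₂ lam β γ : ℝ, 0 < ω₂ → 0 ≤ lam → 0 ≤ β → 0 < γ → ∀ (c : ℕ → Bool) (N : ℕ), 0 < N →
      ∀ T_L T_R : ℝ, 0 < T_L → 0 < T_R →
        ∀ μ : Measure (PhaseSpace N),
          (cellChain ω₂ lam β γ c).IsSteadyState N T_L T_R μ → HasSmoothDensity μ := by
  intro ω₂ lam β γ _ _ hβ hγ c N hN T_L T_R hL hR μ hμ
  exact cellChain_hasSmoothDensity_of_isSteadyState
    Literature.Analysis.Hypoelliptic.hormander1967_thm11_proof hβ hγ c hN hL hR.le hμ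

end Summit.AtomisticToContinuum.FouriersLaw.Theorems.PrefixSteadyStates.LineRegistered

end
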